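import Summits.BirchSwinnertonDyer.Rank1Residual.ManinAdditive.ThetaFourOmegaCusps
import Summits.BirchSwinnertonDyer.BirchSwinnertonDyer.Theorems.ManinLocalTwoThreePlaneIndexTransport
import Mathlib.NumberTheory.LegendreSymbol.QuadraticChar.Basic
import HarnessLib

/-!
# E-desc-156 at `e = 1`: the cusp-`1/3` row 156γ FOLLOWS from the cusp-`0` row 156β (kernel theorem)

Cell bsd-f2-manin, prover seat p3 g17; formalises refuter-1 §R194 (b1)/(b2) (R-desc-38) for desc's theta-visibility
line on C3 `ManinPrimeToThreeAtNine` (stmt-BirchSwinnertonDyer-22968).  The only hypothesis is the E-blind row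
`ThetaPairCuspZeroIntegralAtNinePrime` (156β) BY NAME (or 156β⁺ via the tree's `thetaPairCuspZeroIntegral_of_closed`).
(D) `(−1)^{θ̃₄(γ)} = χ₋₃(Nrd γ)` on every norm shell prime to `3`; `thetaCoeff12 1 p n (conj ∘ u) x =
χ₋₃(n)·conj(thetaCoeff12 1 p n u x)`; the `χ₋₃`-twisted pair `(B₃Θ₁, −B₃Θ₂)` is an `e = 1` theta pair for `conj ∘ u`;
(b1) `2·t₃Θ = −Θ + (ζ₃ − ζ₃²)·B₃Θ` on `3`-free support; (b2) 156β on both pairs ⟹ `2m₁m₂(1−ζ₃)·w₉t₃Θ ∈ S(ℤ) + ζ₃S(ℤ)`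
(indeed `2m₁m₂·w₉t₃Θ` already is — the différent allowance is not used) ⟹ E-desc-156 at `e = 1`.
BSD is not proved by this; `3 ∤ c_E` is not proved by this; C3 is OPEN.
-/

set_option autoImplicit false
set_option linter.dupNamespace false

namespace Summit.BirchSwinnertonDyer.BirchSwinnertonDyer.Theorems.ManinLocalTwoThree.ThetaPairCuspThird

open scoped MatrixGroups ModularForm
open CongruenceSubgroup Literature.NumberTheory.EllipticCurves.ModularForms
open Summit.BirchSwinnertonDyer.Rank1Residual.ManinAdditive.HurwitzBrandt (DQuat)
open Summit.BirchSwinnertonDyer.Rank1Residual.ManinAdditive.ThetaFourBrandt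
  Summit.BirchSwinnertonDyer.Rank1Residual.ManinAdditive.ThetaFourOmega
  Summit.BirchSwinnertonDyer.Rank1Residual.ManinAdditive.ConwayNortonThree
  Summit.BirchSwinnertonDyer.Rank1Residual.ManinAdditive.NeronCuspThree
  Summit.BirchSwinnertonDyer.Rank1Residual.ManinAdditive.NeronOmegaThree
  Summit.BirchSwinnertonDyer.Rank1Residual.ManinAdditive.NeronOmegaGenus

/-! ### §1. `ℤ[i]` bookkeeping: `i^k · z̄ = (−1)^k · conj (i^k z)` -/

/-- `i^k (−z) = −(i^k z)`, componentwise. [folklore] -/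
theorem iPowMul_neg (k : ℕ) (z : ZI) :
    ZI.iPowMul k (-z.1, -z.2) = (-(ZI.iPowMul k z).1, -(ZI.iPowMul k z).2) := by
  induction k generalizing z with
  | zero => rfl
  | succ k ih =>
    show ZI.iPowMul k (-(-z.2), -z.1) = (-(ZI.iPowMul k (-z.2, z.1)).1, -(ZI.iPowMul k (-z.2, z.1)).2)
    rw [← ih (-z.2, z.1)]

/-- `i^k z̄ = (−1)^k conj (i^k z)`, componentwise. [folklore] -/
theorem iPowMul_conj (k : ℕ) (z : ZI) :
    ZI.iPowMul k (ZI.conj z) =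
      ((-1 : ℤ) ^ k * (ZI.iPowMul k z).1, -((-1 : ℤ) ^ k * (ZI.iPowMul k z).2)) := by
  induction k generalizing z with
  | zero => simp [ZI.iPowMul, ZI.conj]
  | succ k ih =>
    show ZI.iPowMul k (-(-z.2), z.1) =
      ((-1 : ℤ) ^ (k + 1) * (ZI.iPowMul k (-z.2, z.1)).1, -((-1 : ℤ) ^ (k + 1) * (ZI.iPowMul k (-z.2, z.1)).2))
    have h1 : ZI.iPowMul k (-(-z.2), z.1) = ZI.iPowMul k (ZI.conj (z.2, -z.1)) := by
      simp only [ZI.conj, neg_neg]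
    have h2 : ZI.iPowMul k (-z.2, z.1) = ZI.iPowMul k (-(z.2, -z.1).1, -(z.2, -z.1).2) := by
      simp only [neg_neg]
    rw [h1, ih, h2, iPowMul_neg, pow_succ]
    ext <;> push_cast <;> ring

/-! ### §2. The dictionary `(−1)^{θ̃₄(γ)} = χ₋₃(Nrd γ)` -/

/-- `θ̃₄` depends only on `(A mod 3, B mod 3)`. [folklore] -/
theorem theta4Exp_eq_mod (q : DQuat) :
    theta4Exp q = theta4Exp (q.1 % 3, q.2.1 % 3, 0, 0) := by
  have hx : (-q.1) % 3 = (-(q.1 % 3)) % 3 := by omega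
  have hy : (-q.2.1) % 3 = (-(q.2.1 % 3)) % 3 := by omega
  simp only [theta4Exp, hx, hy]

/-- DICTIONARY (D): for `3 ∤ A² + B²`, `(−1)^{θ̃₄(A,B,C,D)} = +1` if `A² + B² ≡ 1 (mod 3)` and `−1` if `≡ 2`.
(`θ₄(γ) = γ̄²` for `γ̄ = x + yi ∈ 𝔽₉`, so `θ₄(γ)² = N_{𝔽₉/𝔽₃}(γ̄) = x² + y²`.) [folklore] -/
theorem neg_one_pow_theta4Exp (q : DQuat) (h3 : ¬ (3 : ℤ) ∣ q.1 ^ 2 + q.2.1 ^ 2) :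
    (-1 : ℤ) ^ theta4Exp q = if (q.1 ^ 2 + q.2.1 ^ 2) % 3 = 1 then 1 else -1 := by
  rw [theta4Exp_eq_mod]
  have hsq : (q.1 ^ 2 + q.2.1 ^ 2) % 3 = ((q.1 % 3) ^ 2 + (q.2.1 % 3) ^ 2) % 3 := by
    exact ((Int.mod_modEq q.1 3).symm.pow 2).add ((Int.mod_modEq q.2.1 3).symm.pow 2)
  have h3' : ¬ (3 : ℤ) ∣ (q.1 % 3) ^ 2 + (q.2.1 % 3) ^ 2 := by
    rwa [Int.dvd_iff_emod_eq_zero, ← hsq, ← Int.dvd_iff_emod_eq_zero]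
  rw [hsq]
  have h4 : 0 ≤ q.1 % 3 ∧ q.1 % 3 < 3 ∧ 0 ≤ q.2.1 % 3 ∧ q.2.1 % 3 < 3 := by omega
  obtain ⟨ha0, ha3, hb0, hb3⟩ := h4
  generalize q.1 % 3 = a at *
  generalize q.2.1 % 3 = b at *
  interval_cases a <;> interval_cases b <;> first | decide | exact absurd (by decide) h3'

/-- membership in `dicyclicOfNorm n` forces `A² + B² + 3C² + 3D² = 4n`. [folklore] -/
theorem dnorm3_eq_of_mem {n : ℕ} {γ : DQuat} (h : γ ∈ dicyclicOfNorm n) : dnorm3 γ = 4 * (n : ℤ) := by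
  simp only [dicyclicOfNorm, List.mem_filter, Bool.and_eq_true, beq_iff_eq] at h
  exact h.2.2

/-- DICTIONARY (D) on the norm-`n` shell: `(−1)^{θ̃₄(γ)} = χ₋₃(n)` for every `γ ∈ O` of reduced norm `n`, `3 ∤ n`.
[folklore] -/
theorem neg_one_pow_theta4Exp_of_mem {n : ℕ} (hn : ¬ 3 ∣ n) {γ : DQuat} (h : γ ∈ dicyclicOfNorm n) :
    (-1 : ℤ) ^ theta4Exp γ = if n % 3 = 1 then 1 else -1 := by
  have hd := dnorm3_eq_of_mem h
  unfold dnorm3 at hd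
  have hmod : (4 * (n : ℤ)) % 3 = (γ.1 ^ 2 + γ.2.1 ^ 2) % 3 :=
    Int.modEq_iff_dvd.mpr ⟨-(γ.2.2.1 ^ 2 + γ.2.2.2 ^ 2), by linarith [hd]⟩
  have hsq : (γ.1 ^ 2 + γ.2.1 ^ 2) % 3 = ((n % 3 : ℕ) : ℤ) := by
    rw [← hmod]; push_cast; omega
  have h3 : ¬ (3 : ℤ) ∣ γ.1 ^ 2 + γ.2.1 ^ 2 := by
    rw [Int.dvd_iff_emod_eq_zero, hsq]
    exact_mod_cast fun h0 => hn (Nat.dvd_of_mod_eq_zero h0)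
  rw [neg_one_pow_theta4Exp γ h3, hsq]
  by_cases h1 : n % 3 = 1
  · simp [h1]
  · rw [if_neg h1, if_neg (by exact_mod_cast h1)]

/-! ### §3. The coefficient identity under complex conjugation -/

/-- the shell sum for `conj ∘ u` is `s · conj` of the shell sum for `u`, when `(−1)^{θ̃₄} = s` on the shell.
[folklore] -/
theorem foldr_conj_aux (p : ℕ) (u : Fin (p + 1) → ZI) (x : Fin (p + 1)) (s : ℤ) (L : List DQuat)
    (hL : ∀ γ ∈ L, (-1 : ℤ) ^ theta4Exp γ = s) :
    (L.map fun γ => ZI.iPowMul (theta4Exp γ) (ZI.conj (u (act3 p γ x)))).foldr ZI.add (0, 0) =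
      (s * ((L.map fun γ => ZI.iPowMul (theta4Exp γ) (u (act3 p γ x))).foldr ZI.add (0, 0)).1,
       -(s * ((L.map fun γ => ZI.iPowMul (theta4Exp γ) (u (act3 p γ x))).foldr ZI.add (0, 0)).2)) := by
  induction L with
  | nil => simp
  | cons γ L ih =>
    have hγ : (-1 : ℤ) ^ theta4Exp γ = s := hL γ (by simp)
    have ih' := ih (fun δ hδ => hL δ (List.mem_cons_of_mem _ hδ))
    simp only [List.map_cons, List.foldr_cons] at ih' ⊢
    rw [ih', iPowMul_conj, hγ]
    simp only [ZI.add]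
    ext <;> ring

/-- **COEFFICIENT IDENTITY: `Θ^{(1)}[conj ∘ u] = χ₋₃ ⊗ conj Θ^{(1)}[u]`**, i.e.
`thetaCoeff12 1 p n (conj ∘ u) x = (χ₋₃(n)·Re, −χ₋₃(n)·Im)` of `thetaCoeff12 1 p n u x` (both sides `0` for `3 ∣ n`).
[folklore] -/
theorem thetaCoeff12_one_conj (p n : ℕ) (u : Fin (p + 1) → ZI) (x : Fin (p + 1)) :
    thetaCoeff12 1 p n (ZI.conj ∘ u) x =
      ((if n % 3 = 1 then (1 : ℤ) else -1) * (thetaCoeff12 1 p n u x).1,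
       -((if n % 3 = 1 then (1 : ℤ) else -1) * (thetaCoeff12 1 p n u x).2)) := by
  by_cases h3 : 3 ∣ n
  · simp [thetaCoeff12, h3]
  · simp only [thetaCoeff12, if_neg h3, Function.comp_apply, one_mul]
    exact foldr_conj_aux p u x _ (dicyclicOfNorm n) (fun γ hγ => neg_one_pow_theta4Exp_of_mem h3 hγ)

/-! ### §4. The `χ₋₃`-twisted theta pair -/

/-- `χ₋₃ := quadraticChar 𝔽₃ ⊗ ℂ` is a quadratic Dirichlet character mod `3`. [folklore] -/
theorem isQuadratic_chi3 :
    MulChar.IsQuadratic ((quadraticChar (ZMod 3)).ringHomComp (Int.castRingHom ℂ) : DirichletCharacter ℂ 3) :=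
  (quadraticChar_isQuadratic (ZMod 3)).comp _

/-- `χ₋₃` is primitive (non-trivial of prime level).
-- adapted from `Literature/NumberTheory/EllipticCurves/RootNumberTwistProofs.lean` (`p := 3`) to keep this file's
-- import cone inside the landed `ManinAdditive` modules. [folklore] -/
theorem isPrimitive_chi3 :
    DirichletCharacter.IsPrimitive
      ((quadraticChar (ZMod 3)).ringHomComp (Int.castRingHom ℂ) : DirichletCharacter ℂ 3) := by
  haveI : Fact (Nat.Prime 3) := ⟨Nat.prime_three⟩
  rw [DirichletCharacter.isPrimitive_def]
  have hdvd := DirichletCharacter.conductor_dvd_level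
    ((quadraticChar (ZMod 3)).ringHomComp (Int.castRingHom ℂ))
  rcases (Nat.dvd_prime Nat.prime_three).mp hdvd with h1 | h
  · exfalso
    have hone := DirichletCharacter.eq_one_iff_conductor_eq_one.mpr h1
    have hF : ringChar (ZMod 3) ≠ 2 := by rw [ZMod.ringChar_zmod_n]; norm_num
    obtain ⟨a, ha⟩ := quadraticChar_exists_neg_one hF
    have hau : IsUnit a := by
      by_contra hau
      rw [MulChar.map_nonunit _ hau] at ha
      norm_num at ha
    have h2 := congrArg (fun χ : DirichletCharacter ℂ 3 ↦ χ a) hone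
    simp only [MulChar.ringHomComp_apply, ha] at h2
    rw [← hau.unit_spec, MulChar.one_apply_coe] at h2
    norm_num at h2
  · exact h

/-- `χ₋₃(n) = ±1` (`+1` iff `n ≡ 1 (mod 3)`) at `3 ∤ n`, and `0` at `3 ∣ n`. [folklore] -/
theorem chi3_natCast_eq_ite (n : ℕ) :
    ((quadraticChar (ZMod 3)).ringHomComp (Int.castRingHom ℂ) : DirichletCharacter ℂ 3) n =
      if 3 ∣ n then 0 else (((if n % 3 = 1 then (1 : ℤ) else -1) : ℤ) : ℂ) := by
  by_cases h3 : 3 ∣ n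
  · rw [if_pos h3]
    exact Summit.BirchSwinnertonDyer.Rank1Residual.O5.chi_three_natCast_eq_zero _ h3
  · rw [if_neg h3]
    by_cases h1 : n % 3 = 1
    · have hn1 : (n : ZMod 3) = 1 := by rw [← ZMod.natCast_mod, h1]; rfl
      rw [if_pos h1, hn1, map_one]; simp
    · have h2 : n % 3 = 2 := by omega
      have hn2 : (n : ZMod 3) = 2 := by rw [← ZMod.natCast_mod, h2]; rfl
      rw [if_neg h1, hn2, Summit.BirchSwinnertonDyer.Rank1Residual.O5.chi_three_apply_two isQuadratic_chi3
        isPrimitive_chi3]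
      simp

variable {N : ℕ} [NeZero N]

omit [NeZero N] in
/-- a theta pair is supported on `3 ∤ n` (incl. `a₀ = 0`). [folklore] -/
theorem cuspCoeff_eq_zero_of_isThetaPair {e p : ℕ} {u : Fin (p + 1) → ZI} {x : Fin (p + 1)}
    {Θ₁ Θ₂ : CuspForm (Gamma0 N) 2} (h : IsThetaPair e p N u x Θ₁ Θ₂) {n : ℕ} (hn : 3 ∣ n) :
    cuspCoeff Θ₁ n = 0 ∧ cuspCoeff Θ₂ n = 0 := by
  rcases Nat.eq_zero_or_pos n with rfl | hpos
  · exact ⟨cuspCoeff_zero (one_mem_strictPeriods_coe_gamma0 N) Θ₁,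
      cuspCoeff_zero (one_mem_strictPeriods_coe_gamma0 N) Θ₂⟩
  · obtain ⟨h₁, h₂⟩ := h n hpos
    rw [h₁, h₂]
    simp [thetaCoeff12, hn]

/-- **TWISTED PAIR: `(B₃ Θ₁, −B₃ Θ₂)` is a theta pair at `e = 1` for `conj ∘ u`** (`9 ∣ N`; `B₃ = twistOperatorAtThree`,
`aₙ ↦ χ₋₃(n) aₙ` by the tree's `cuspCoeff_twistOperatorAtThree_two` with `χ = χ₋₃`). [folklore] -/
theorem isThetaPair_twist_one {p : ℕ} (h9 : 9 ∣ N) {u : Fin (p + 1) → ZI} {x : Fin (p + 1)}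
    {Θ₁ Θ₂ : CuspForm (Gamma0 N) 2} (h : IsThetaPair 1 p N u x Θ₁ Θ₂) :
    IsThetaPair 1 p N (ZI.conj ∘ u) x (twistOperatorAtThree N 2 Θ₁) (-(twistOperatorAtThree N 2 Θ₂)) := by
  have hχq := isQuadratic_chi3
  have hχp := isPrimitive_chi3
  have hΓ : (1 : ℝ) ∈ (Gamma0 N : Subgroup (GL (Fin 2) ℝ)).strictPeriods := one_mem_strictPeriods_coe_gamma0 N
  intro n hn
  obtain ⟨h₁, h₂⟩ := h n hn
  rw [thetaCoeff12_one_conj]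
  refine ⟨?_, ?_⟩
  · rw [cuspCoeff_twistOperatorAtThree_two h9 hχq hχp, h₁, chi3_natCast_eq_ite]
    by_cases h3 : 3 ∣ n
    · simp [thetaCoeff12, h3]
    · rw [if_neg h3]; push_cast; ring
  · rw [← cuspCoeffₗ_apply hΓ n, map_neg, cuspCoeffₗ_apply, cuspCoeff_twistOperatorAtThree_two h9 hχq hχp, h₂,
      chi3_natCast_eq_ite]
    by_cases h3 : 3 ∣ n
    · simp [thetaCoeff12, h3]
    · rw [if_neg h3]; push_cast; ring

/-! ### §5. (b1): `2 · t₃ Θ = −Θ + (ζ₃ − ζ₃²) · B₃ Θ` on forms supported on `3 ∤ n` -/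

/-- **(b1) EXACT IDENTITY: `2 · t₃ Θ = −Θ + (ζ₃ − ζ₃²) · B₃ Θ`** for every `Θ ∈ S₂(Γ₀(N))`, `9 ∣ N`, whose
`q`-expansion is supported on `3 ∤ n` (`ζ₃ⁿ = −½ + χ₋₃(n)(ζ₃ − ζ₃²)/2`; q-expansion principle). [folklore] -/
theorem two_smul_thirdTranslate_eq (h9 : 9 ∣ N) (Θ : CuspForm (Gamma0 N) 2)
    (hΘ : ∀ n, 3 ∣ n → cuspCoeff Θ n = 0) :
    (2 : ℂ) • thirdTranslate N 2 1 Θ = -Θ + (zeta3 - zeta3 ^ 2) • twistOperatorAtThree N 2 Θ := by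
  have hΓ : (1 : ℝ) ∈ (Gamma0 N : Subgroup (GL (Fin 2) ℝ)).strictPeriods := one_mem_strictPeriods_coe_gamma0 N
  have hζ := isPrimitiveRoot_zeta3
  have h3 : zeta3 ^ 3 = 1 := hζ.pow_eq_one
  refine eq_of_forall_cuspCoeff_eq_gamma0 fun n => ?_
  have hB : cuspCoeff (twistOperatorAtThree N 2 Θ) n =
      (zeta3 - zeta3 ^ 2)⁻¹ * (((zeta3 ^ 1) ^ n - (zeta3 ^ 2) ^ n) * cuspCoeff Θ n) := by
    have hdef : twistOperatorAtThree N 2 Θ =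
        (zeta3 - zeta3 ^ 2)⁻¹ • (thirdTranslate N 2 1 Θ - thirdTranslate N 2 2 Θ) := by
      simp only [twistOperatorAtThree, LinearMap.smul_apply, LinearMap.sub_apply]
    rw [hdef, ← cuspCoeffₗ_apply hΓ n, map_smul, map_sub, cuspCoeffₗ_apply, cuspCoeffₗ_apply,
      cuspCoeff_thirdTranslate_two h9 1, cuspCoeff_thirdTranslate_two h9 2, smul_eq_mul]
    ring
  have e1 : cuspCoeff ((2 : ℂ) • thirdTranslate N 2 1 Θ) n = 2 * cuspCoeff (thirdTranslate N 2 1 Θ) n := by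
    rw [← cuspCoeffₗ_apply hΓ n, map_smul, smul_eq_mul, cuspCoeffₗ_apply]
  have e2 : cuspCoeff (-Θ + (zeta3 - zeta3 ^ 2) • twistOperatorAtThree N 2 Θ) n =
      -cuspCoeff Θ n + (zeta3 - zeta3 ^ 2) * cuspCoeff (twistOperatorAtThree N 2 Θ) n := by
    rw [← cuspCoeffₗ_apply hΓ n, map_add, map_neg, map_smul, smul_eq_mul, cuspCoeffₗ_apply, cuspCoeffₗ_apply]
  rw [e1, e2, hB, cuspCoeff_thirdTranslate_two h9 1, mul_inv_cancel_left₀ zeta3_sub_sq_ne_zero]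
  by_cases h3n : 3 ∣ n
  · rw [hΘ n h3n]; ring
  · have hw1 : (zeta3 ^ 1) ^ n ≠ 1 := by
      rw [pow_one]; exact fun h => h3n ((hζ.pow_eq_one_iff_dvd n).mp h)
    have hw3 : ((zeta3 ^ 1) ^ n) ^ 3 = 1 := by
      rw [pow_one, ← pow_mul, mul_comm, pow_mul, h3, one_pow]
    have hw : ((zeta3 ^ 1) ^ n) ^ 2 + (zeta3 ^ 1) ^ n + 1 = 0 := by
      have h0 : ((zeta3 ^ 1) ^ n - 1) * (((zeta3 ^ 1) ^ n) ^ 2 + (zeta3 ^ 1) ^ n + 1) = 0 := by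
        linear_combination hw3
      exact (mul_eq_zero.mp h0).resolve_left (sub_ne_zero.mpr hw1)
    have h22 : (zeta3 ^ 2) ^ n = ((zeta3 ^ 1) ^ n) ^ 2 := by
      rw [pow_one, ← pow_mul, ← pow_mul, mul_comm]
    rw [h22]
    linear_combination (cuspCoeff Θ n) * hw

/-! ### §6. (b2): the cusp-`1/3` condition from the cusp-`0` condition on `Θ` and on `B₃ Θ` -/

/-- **SLACK FORM.** If `w₉ Θ` and `w₉ (B₃ Θ)` are `3`-integral and `Θ` is supported on `3 ∤ n`, a prime-to-`3` multiple
of `w₉ (t₃ Θ)` lies in `S(ℤ) + ζ₃ S(ℤ)` OUTRIGHT: `2m₁m₂·w₉t₃Θ = (−m₁m₂ w₉Θ + m₁m₂ w₉B₃Θ) + ζ₃·(2m₁m₂ w₉B₃Θ)`. [folklore] -/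
theorem isEisensteinIntegral_smul_of_isThreeIntegral (h9 : 9 ∣ N) {Θ : CuspForm (Gamma0 N) 2}
    (hΘ : ∀ n, 3 ∣ n → cuspCoeff Θ n = 0)
    (hA : IsThreeIntegral N (atkinLehnerInvolutionAt N 2 3 Θ))
    (hB : IsThreeIntegral N (atkinLehnerInvolutionAt N 2 3 (twistOperatorAtThree N 2 Θ))) :
    ∃ m : ℕ, ¬ 3 ∣ m ∧
      IsEisensteinIntegral N ((m : ℂ) • atkinLehnerInvolutionAt N 2 3 (thirdTranslate N 2 1 Θ)) := by
  obtain ⟨m₁, hm₁, hS₁⟩ := hA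
  obtain ⟨m₂, hm₂, hS₂⟩ := hB
  have h2 : (2 : ℂ) • atkinLehnerInvolutionAt N 2 3 (thirdTranslate N 2 1 Θ) =
      -atkinLehnerInvolutionAt N 2 3 Θ +
        (zeta3 - zeta3 ^ 2) • atkinLehnerInvolutionAt N 2 3 (twistOperatorAtThree N 2 Θ) := by
    rw [← map_smul, two_smul_thirdTranslate_eq h9 Θ hΘ, map_add, map_neg, map_smul]
  have hζv : (1 + zeta3 + zeta3 ^ 2) •
      (((m₁ : ℂ) * m₂) • atkinLehnerInvolutionAt N 2 3 (twistOperatorAtThree N 2 Θ)) = 0 := by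
    rw [one_add_zeta3_add_sq, zero_smul]
  refine ⟨2 * m₁ * m₂, fun h => ?_, ?_⟩
  · rcases (Nat.Prime.dvd_mul Nat.prime_three).mp h with h | h
    · rcases (Nat.Prime.dvd_mul Nat.prime_three).mp h with h | h
      · omega
      · exact hm₁ h
    · exact hm₂ h
  refine ⟨-((m₂ : ℤ) • ((m₁ : ℂ) • atkinLehnerInvolutionAt N 2 3 Θ)) +
      (m₁ : ℤ) • ((m₂ : ℂ) • atkinLehnerInvolutionAt N 2 3 (twistOperatorAtThree N 2 Θ)),
    add_mem (neg_mem (Submodule.smul_mem _ _ hS₁)) (Submodule.smul_mem _ _ hS₂),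
    (2 * m₁ : ℤ) • ((m₂ : ℂ) • atkinLehnerInvolutionAt N 2 3 (twistOperatorAtThree N 2 Θ)),
    Submodule.smul_mem _ _ hS₂, ?_⟩
  simp only [← Int.cast_smul_eq_zsmul ℂ]
  push_cast
  linear_combination (norm := module) ((m₁ : ℂ) * m₂) • h2 + (-1 : ℂ) • hζv

/-- **(C_1) FROM (C_0).** Same hypotheses ⟹ `IsPiIntegralUpToDifferent N (w (t₃ Θ))` (the différent allowance is not
used: `2m₁m₂(1−ζ₃) · w t₃ Θ = (−m₁m₂ wΘ + 3m₁m₂ w B₃Θ) + ζ₃ · (m₁m₂ wΘ + 3m₁m₂ w B₃Θ)`). [folklore] -/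
theorem isPiIntegralUpToDifferent_of_isThreeIntegral (h9 : 9 ∣ N) {Θ : CuspForm (Gamma0 N) 2}
    (hΘ : ∀ n, 3 ∣ n → cuspCoeff Θ n = 0)
    (hA : IsThreeIntegral N (atkinLehnerInvolutionAt N 2 3 Θ))
    (hB : IsThreeIntegral N (atkinLehnerInvolutionAt N 2 3 (twistOperatorAtThree N 2 Θ))) :
    IsPiIntegralUpToDifferent N (atkinLehnerInvolutionAt N 2 3 (thirdTranslate N 2 1 Θ)) := by
  obtain ⟨m₁, hm₁, hS₁⟩ := hA
  obtain ⟨m₂, hm₂, hS₂⟩ := hB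
  have h2 : (2 : ℂ) • atkinLehnerInvolutionAt N 2 3 (thirdTranslate N 2 1 Θ) =
      -atkinLehnerInvolutionAt N 2 3 Θ +
        (zeta3 - zeta3 ^ 2) • atkinLehnerInvolutionAt N 2 3 (twistOperatorAtThree N 2 Θ) := by
    rw [← map_smul, two_smul_thirdTranslate_eq h9 Θ hΘ, map_add, map_neg, map_smul]
  have hζv : (1 + zeta3 + zeta3 ^ 2) •
      (((m₁ : ℂ) * m₂) • atkinLehnerInvolutionAt N 2 3 (twistOperatorAtThree N 2 Θ)) = 0 := by
    rw [one_add_zeta3_add_sq, zero_smul]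
  refine ⟨2 * m₁ * m₂, fun h => ?_, ?_⟩
  · rcases (Nat.Prime.dvd_mul Nat.prime_three).mp h with h | h
    · rcases (Nat.Prime.dvd_mul Nat.prime_three).mp h with h | h
      · omega
      · exact hm₁ h
    · exact hm₂ h
  refine ⟨-((m₂ : ℤ) • ((m₁ : ℂ) • atkinLehnerInvolutionAt N 2 3 Θ)) +
      (3 * m₁ : ℤ) • ((m₂ : ℂ) • atkinLehnerInvolutionAt N 2 3 (twistOperatorAtThree N 2 Θ)),
    add_mem (neg_mem (Submodule.smul_mem _ _ hS₁)) (Submodule.smul_mem _ _ hS₂),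
    (m₂ : ℤ) • ((m₁ : ℂ) • atkinLehnerInvolutionAt N 2 3 Θ) +
      (3 * m₁ : ℤ) • ((m₂ : ℂ) • atkinLehnerInvolutionAt N 2 3 (twistOperatorAtThree N 2 Θ)),
    add_mem (Submodule.smul_mem _ _ hS₁) (Submodule.smul_mem _ _ hS₂), ?_⟩
  simp only [← Int.cast_smul_eq_zsmul ℂ]
  push_cast
  linear_combination (norm := module) ((m₁ : ℂ) * m₂ * (1 - zeta3)) • h2 + (zeta3 - 3) • hζv

/-! ### §7. Headline: 156β at `e = 1` ⟹ 156γ at `e = 1` ⟹ E-desc-156 at `e = 1` -/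

/-- **156β|ₑ₌₁ ⟹ 156γ|ₑ₌₁ (refuter-1 §R194 (b2), kernel form).**  From the cusp-`0` row 156β (used at `e = 1` on the
pair AND on its `χ₋₃`-twist, which is again an `e = 1` theta pair by §4) the cusp-`1/3` row follows for every `e = 1`
theta pair on `Γ₀(9p)` — WITH SLACK (`isEisensteinIntegral_smul_of_isThreeIntegral`). [folklore] -/
theorem thetaPairCuspThird_of_cuspZero_one (hβ : ThetaPairCuspZeroIntegralAtNinePrime) (p : ℕ) [NeZero (9 * p)]
    (hp : p.Prime) (h5 : 5 ≤ p) (u : Fin (p + 1) → ZI) (x : Fin (p + 1))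
    (Θ₁ Θ₂ : CuspForm (Gamma0 (9 * p)) 2) (h : IsThetaPair 1 p (9 * p) u x Θ₁ Θ₂) :
    IsPiIntegralUpToDifferent (9 * p) (atkinLehnerInvolutionAt (9 * p) 2 3 (thirdTranslate (9 * p) 2 1 Θ₁)) ∧
      IsPiIntegralUpToDifferent (9 * p)
        (atkinLehnerInvolutionAt (9 * p) 2 3 (thirdTranslate (9 * p) 2 1 Θ₂)) := by
  have h9 : 9 ∣ 9 * p := dvd_mul_right 9 p
  obtain ⟨hA₁, hA₂⟩ := hβ p 1 hp h5 (Or.inl rfl) u x Θ₁ Θ₂ h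
  obtain ⟨hB₁, hB₂⟩ := hβ p 1 hp h5 (Or.inl rfl) (ZI.conj ∘ u) x _ _ (isThetaPair_twist_one h9 h)
  have hB₂' : IsThreeIntegral (9 * p)
      (atkinLehnerInvolutionAt (9 * p) 2 3 (twistOperatorAtThree (9 * p) 2 Θ₂)) := by
    rw [map_neg] at hB₂
    simpa using isThreeIntegral_zsmul hB₂ (-1)
  exact ⟨isPiIntegralUpToDifferent_of_isThreeIntegral h9 (fun n hn => (cuspCoeff_eq_zero_of_isThetaPair h hn).1) hA₁ hB₁,
    isPiIntegralUpToDifferent_of_isThreeIntegral h9 (fun n hn => (cuspCoeff_eq_zero_of_isThetaPair h hn).2) hA₂ hB₂'⟩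

/-- **E-desc-156 AT `e = 1` ⟸ 156β** (`ThetaFourOmegaIntegralAtNinePrime` restricted to the character `θ₄`, i.e. the
Kodaira III/III* stratum relevant to C3): membership in `Ω₃(9p)` from 156α + 156β + this file's (C_1). [folklore] -/
theorem thetaFourOmegaIntegral_one_of_cuspZero (hβ : ThetaPairCuspZeroIntegralAtNinePrime) (p : ℕ)
    [NeZero (9 * p)] (hp : p.Prime) (h5 : 5 ≤ p) (u : Fin (p + 1) → ZI) (x : Fin (p + 1))
    (Θ₁ Θ₂ : CuspForm (Gamma0 (9 * p)) 2) (h : IsThetaPair 1 p (9 * p) u x Θ₁ Θ₂) :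
    Θ₁ ∈ omegaLatticeAtThree (9 * p) ∧ Θ₂ ∈ omegaLatticeAtThree (9 * p) := by
  have h27 : ¬ 27 ∣ 9 * p := by
    intro h27
    have h3 : 3 ∣ p := by
      have : 3 * 9 ∣ p * 9 := by simpa [mul_comm] using h27
      exact (Nat.mul_dvd_mul_iff_right (by norm_num : 0 < 9)).mp this
    have := (Nat.prime_dvd_prime_iff_eq Nat.prime_three hp).mp h3
    omega
  obtain ⟨hi₁, hi₂⟩ := h.mem_integralCuspForms0
  obtain ⟨h0₁, h0₂⟩ := hβ p 1 hp h5 (Or.inl rfl) u x Θ₁ Θ₂ h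
  obtain ⟨h1₁, h1₂⟩ := thetaPairCuspThird_of_cuspZero_one hβ p hp h5 u x Θ₁ Θ₂ h
  exact ⟨mem_omegaLatticeAtThree_of hi₁ h0₁ h1₁ fun h' => absurd h' h27,
    mem_omegaLatticeAtThree_of hi₂ h0₂ h1₂ fun h' => absurd h' h27⟩

/-- **E-desc-156 AT `e = 1` ⟸ 156β⁺** (the structure row «`w₉` maps theta pairs to theta pairs»): the single open E-blind
input of desc's theta-visibility chain on the type-III stratum (refuter-1 §R194 (b4)). [folklore] -/
theorem thetaFourOmegaIntegral_one_of_closed (hc : ThetaPairAtkinLehnerClosedAtNinePrime) (p : ℕ)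
    [NeZero (9 * p)] (hp : p.Prime) (h5 : 5 ≤ p) (u : Fin (p + 1) → ZI) (x : Fin (p + 1))
    (Θ₁ Θ₂ : CuspForm (Gamma0 (9 * p)) 2) (h : IsThetaPair 1 p (9 * p) u x Θ₁ Θ₂) :
    Θ₁ ∈ omegaLatticeAtThree (9 * p) ∧ Θ₂ ∈ omegaLatticeAtThree (9 * p) :=
  thetaFourOmegaIntegral_one_of_cuspZero (thetaPairCuspZeroIntegral_of_closed hc) p hp h5 u x Θ₁ Θ₂ h

end Summit.BirchSwinnertonDyer.BirchSwinnertonDyer.Theorems.ManinLocalTwoThree.ThetaPairCuspThird
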